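import Summits.Ventures.CertifiedArithmetic.LowPrec.CompensatedEFT

/-!
# Discharging the range side conditions from the data: `(1 + (n-1)u)·Σ|xᵢ| ≤ maxRat` suffices

HONEST FRAMING (venture CertifiedArithmetic / cell `pub-lowprec`): certified error envelopes and
provably optimal rounding/accumulation schemes for low-precision formats under stated cost models;
every table by two implementations; no hardware or vendor claims.

The accumulation theorems of the venture (`AccumulateSharp.lean`: any order, `(n-1)u/(1+u)`;
`CompensatedSum.lean` / `CompensatedEFT.lean`: compensated, `u|s| + n(n-1)u²Σ|xᵢ|`) carry the GEMM
model's `FIN` hypothesis — every intermediate sum stays within `±maxRat` — as conditions on the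
algorithm's own intermediate states. This file replaces them by ONE a-priori inequality on the data:
* `treeInRange_of_absSum_le`: leaves in `F_α` and `(1 + (n-1)·u')·Σ|xᵢ| ≤ maxRat` (`u' = u/(1+u)`)
  imply that every node of ANY evaluation tree is in range (induction: a subtree's computed value is
  at most `(1 + (n'-1)u')` times its leaf sum, `abs_eval_le_of_treeInRange`); hence the sharp
  any-order bound under that single hypothesis (`abs_eval_sub_exact_le_sharp_of_absSum_le`);
* `compSum_ranges`: for a compensated scheme with an error-free correction step, leaves in `F_α` and
  `(1 + n·u')²·Σ|xᵢ| ≤ maxRat` put the main chain, the compensation chain and the final addition in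
  range; hence `abs_compSum_sub_sum_le_of_sum_le`, and for Neumaier's `kbn` and the cascaded-2Sum
  `Sum2` the envelope `|res - s| ≤ u|s| + n(n-1)u²·Σ|xᵢ|` under `xᵢ ∈ F_α ∧ (1 + n·u)²·Σ|xᵢ| ≤ maxRat`
  alone (`abs_kbnSum_sub_sum_le_of_sum_le`, `abs_sum2_sub_sum_le_of_sum_le`).
-/

namespace Literature.ComputerArithmetic.FloatingPoint

namespace MiniFloat

open Finset
open Literature.ComputerArithmetic.JeannerodRump2018
open Literature.ComputerArithmetic.JeannerodRump2018.SumTree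

variable {α : Format}

/-! ### Any evaluation tree -/

/-- A tree in range evaluates to at most `(1 + (n-1)·u/(1+u))·Σ|xᵢ|` in magnitude. [folklore] -/
theorem abs_eval_le_of_treeInRange (hα : 2 ≤ α.emaxCode) (t : SumTree) (ht : TreeInRange α t) :
    |SumTree.eval (flα α) t|
      ≤ (1 + ((t.leaves.length : ℚ) - 1) * (α.unitRoundoff / (1 + α.unitRoundoff))) * absSum t := by
  have h1 := abs_eval_le (flα α) t
  have h2 := absErr_flα_le hα t ht
  have e : (1 + ((t.leaves.length : ℚ) - 1) * (α.unitRoundoff / (1 + α.unitRoundoff))) * absSum t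
      = absSum t + ((t.leaves.length : ℚ) - 1) * (α.unitRoundoff / (1 + α.unitRoundoff)) * absSum t := by
    ring
  rw [e]; linarith

/-- RANGE FROM THE DATA (any order): if the leaves are values of `α` (`emaxCode ≥ 2`) and
`(1 + (n-1)·u/(1+u))·Σ|xᵢ| ≤ maxRat`, then every node of the evaluation tree is in range.
[folklore] -/
theorem treeInRange_of_absSum_le (hα : 2 ≤ α.emaxCode) : ∀ t : SumTree,
    (∀ x ∈ t.leaves, ∃ y : MiniFloat α, y.toRat = x) →
    (1 + ((t.leaves.length : ℚ) - 1) * (α.unitRoundoff / (1 + α.unitRoundoff))) * absSum t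
      ≤ α.maxRat → TreeInRange α t
  | .leaf x, hl, _ => by simpa [TreeInRange, SumTree.leaves] using hl
  | .node l r, hleaves, hS => by
      have hl : ∀ x ∈ l.leaves, ∃ y : MiniFloat α, y.toRat = x :=
        fun x hx => hleaves x (by simp [SumTree.leaves, hx])
      have hr : ∀ x ∈ r.leaves, ∃ y : MiniFloat α, y.toRat = x :=
        fun x hx => hleaves x (by simp [SumTree.leaves, hx])
      set u' := α.unitRoundoff / (1 + α.unitRoundoff) with hu'
      have hupos := α.unitRoundoff_pos
      have hu'0 : 0 ≤ u' := div_nonneg hupos.le (by linarith)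
      have hlen : ((SumTree.node l r).leaves.length : ℚ) = l.leaves.length + r.leaves.length := by
        simp [SumTree.leaves, List.length_append]
      rw [hlen, absSum_node] at hS
      set nl : ℚ := (l.leaves.length : ℚ) with hnl
      set nr : ℚ := (r.leaves.length : ℚ) with hnr
      have hn1 : (1 : ℚ) ≤ nl := by rw [hnl]; exact_mod_cast one_le_length_leaves l
      have hn2 : (1 : ℚ) ≤ nr := by rw [hnr]; exact_mod_cast one_le_length_leaves r
      have hSl := absSum_nonneg l
      have hSr := absSum_nonneg r
      set Sl := absSum l
      set Sr := absSum r
      -- monotonicity of the sufficient condition toward the subtrees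
      have m1 : (nl - 1) * u' * Sl ≤ (nl + nr - 1) * u' * Sl :=
        mul_le_mul_of_nonneg_right (mul_le_mul_of_nonneg_right (by linarith) hu'0) hSl
      have m2 : (nr - 1) * u' * Sr ≤ (nl + nr - 1) * u' * Sr :=
        mul_le_mul_of_nonneg_right (mul_le_mul_of_nonneg_right (by linarith) hu'0) hSr
      have m3 : 0 ≤ (nl + nr - 1) * u' * Sr := mul_nonneg (mul_nonneg (by linarith) hu'0) hSr
      have m4 : 0 ≤ (nl + nr - 1) * u' * Sl := mul_nonneg (mul_nonneg (by linarith) hu'0) hSl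
      have eS : (1 + (nl + nr - 1) * u') * (Sl + Sr)
          = Sl + Sr + (nl + nr - 1) * u' * Sl + (nl + nr - 1) * u' * Sr := by ring
      have ihl := treeInRange_of_absSum_le hα l hl (by
        have e : (1 + (nl - 1) * u') * Sl = Sl + (nl - 1) * u' * Sl := by ring
        rw [e]; linarith)
      have ihr := treeInRange_of_absSum_le hα r hr (by
        have e : (1 + (nr - 1) * u') * Sr = Sr + (nr - 1) * u' * Sr := by ring
        rw [e]; linarith)
      refine ⟨ihl, ihr, ?_⟩
      have bl := abs_eval_le_of_treeInRange hα l ihl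
      have br := abs_eval_le_of_treeInRange hα r ihr
      have el : (1 + (nl - 1) * u') * Sl = Sl + (nl - 1) * u' * Sl := by ring
      have er : (1 + (nr - 1) * u') * Sr = Sr + (nr - 1) * u' * Sr := by ring
      rw [el] at bl
      rw [er] at br
      calc |SumTree.eval (flα α) l + SumTree.eval (flα α) r|
          ≤ |SumTree.eval (flα α) l| + |SumTree.eval (flα α) r| := abs_add_le _ _
        _ ≤ α.maxRat := by linarith

/-- R2, ANY ORDER, SHARP CONSTANT, RANGE FROM THE DATA: leaves in `F_α` (`emaxCode ≥ 2`) and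
`(1 + (n-1)·u/(1+u))·Σ|xᵢ| ≤ maxRat` ⟹ `|ŝ - s| ≤ (n-1)·u/(1+u)·Σ|xᵢ|`. [folklore] -/
theorem abs_eval_sub_exact_le_sharp_of_absSum_le (hα : 2 ≤ α.emaxCode) (t : SumTree)
    (ht : ∀ x ∈ t.leaves, ∃ y : MiniFloat α, y.toRat = x)
    (hS : (1 + ((t.leaves.length : ℚ) - 1) * (α.unitRoundoff / (1 + α.unitRoundoff))) * absSum t
      ≤ α.maxRat) :
    |SumTree.eval (flα α) t - SumTree.exact t|
      ≤ ((t.leaves.length : ℚ) - 1) * (α.unitRoundoff / (1 + α.unitRoundoff)) * absSum t :=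
  abs_eval_sub_exact_le_sharp hα t (treeInRange_of_absSum_le hα t ht hS)

/-! ### The comb (recursive order) -/

/-- The leaves of the comb are the summands. [folklore] -/
theorem forall_leaves_combTree (v : ℕ → ℚ) (P : ℚ → Prop) :
    ∀ n, (∀ i ≤ n, P (v i)) → ∀ y ∈ (combTree v n).leaves, P y
  | 0, h, y, hy => by
      simp only [combTree, SumTree.leaves, List.mem_singleton] at hy
      subst hy; exact h 0 le_rfl
  | n + 1, h, y, hy => by
      simp only [combTree, SumTree.leaves, List.mem_append, List.mem_singleton] at hy
      rcases hy with hy | hy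
      · exact forall_leaves_combTree v P n (fun i hi => h i (Nat.le_succ_of_le hi)) y hy
      · subst hy; exact h (n + 1) le_rfl

/-- Node conditions along a comb in range. [folklore] -/
theorem comb_nodes_of_treeInRange (v : ℕ → ℚ) : ∀ n, TreeInRange α (combTree v n) →
    ∀ k < n, |SumTree.eval (flα α) (combTree v k) + v (k + 1)| ≤ α.maxRat
  | 0, _, k, hk => absurd hk (Nat.not_lt_zero k)
  | n + 1, ⟨hl, _, hnode⟩, k, hk => by
      rcases Nat.lt_succ_iff_lt_or_eq.mp hk with h | h
      · exact comb_nodes_of_treeInRange v n hl k h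
      · subst h; simpa [SumTree.eval] using hnode

/-! ### Compensated schemes -/

section Compensated

variable (corr : ℚ → ℚ → ℚ)
  (hcorr : ∀ a b : MiniFloat α, corr a.toRat b.toRat = a.toRat + b.toRat - flα α (a.toRat + b.toRat))
include hcorr

/-- RANGE FROM THE DATA (compensated schemes with an error-free step): summands in `F_α`
(`emaxCode ≥ 2`) and `(1 + n·u')²·Σ|xᵢ| ≤ maxRat` (`u' = u/(1+u)`) put the main chain, the
compensation chain and the final addition within range. [folklore] -/
theorem compSum_ranges (hα : 2 ≤ α.emaxCode) (x : ℕ → ℚ) (n : ℕ)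
    (hx : ∀ i ≤ n, ∃ y : MiniFloat α, y.toRat = x i)
    (hL : (1 + n * (α.unitRoundoff / (1 + α.unitRoundoff))) ^ 2 * ∑ i ∈ range (n + 1), |x i|
      ≤ α.maxRat) :
    (∀ k < n, |(compSum α corr x k).1 + x (k + 1)| ≤ α.maxRat) ∧
    (∀ k < n, |(compSum α corr x k).2 + corr (compSum α corr x k).1 (x (k + 1))| ≤ α.maxRat) ∧
    |(compSum α corr x n).1 + (compSum α corr x n).2| ≤ α.maxRat := by
  set u' := α.unitRoundoff / (1 + α.unitRoundoff) with hu'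
  have hupos := α.unitRoundoff_pos
  have hu'0 : 0 ≤ u' := div_nonneg hupos.le (by linarith)
  set L := ∑ i ∈ range (n + 1), |x i| with hL_def
  have hL0 : 0 ≤ L := sum_nonneg fun _ _ => abs_nonneg _
  have hn0 : (0 : ℚ) ≤ n := by positivity
  have hnu : 0 ≤ (n : ℚ) * u' := mul_nonneg hn0 hu'0
  -- (1 + n u') L ≤ (1 + n u')² L ≤ maxRat
  have hL1 : (1 + n * u') * L ≤ α.maxRat := by
    refine le_trans ?_ hL
    have : (1 + n * u') * L ≤ (1 + n * u') * ((1 + n * u') * L) :=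
      le_mul_of_one_le_left (mul_nonneg (by linarith) hL0) (by linarith)
    linarith [this, show (1 + n * u') ^ 2 * L = (1 + n * u') * ((1 + n * u') * L) by ring]
  -- main chain: the comb over the summands is in range
  have hleaves : ∀ y ∈ (combTree x n).leaves, ∃ z : MiniFloat α, z.toRat = y :=
    forall_leaves_combTree x _ n hx
  have hT1 : TreeInRange α (combTree x n) := by
    refine treeInRange_of_absSum_le hα _ hleaves ?_
    rw [length_leaves_combTree, absSum_combTree]; push_cast
    rw [show (n : ℚ) + 1 - 1 = n by ring]; exact hL1
  have hr1 : ∀ k < n, |(compSum α corr x k).1 + x (k + 1)| ≤ α.maxRat := by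
    intro k hk
    have := comb_nodes_of_treeInRange x n hT1 k hk
    rwa [eval_combTree_eq_compSum_fst corr x (hx 0 (Nat.zero_le _)) k] at this
  -- (iii) the corrections are small
  have hE : ∑ k ∈ range n, |corr (compSum α corr x k).1 (x (k + 1))| ≤ n * u' * L :=
    sum_abs_compSum_corr_le corr hcorr hα x n hx hr1
  -- compensation chain
  have hr2 : ∀ k < n, |(compSum α corr x k).2 + corr (compSum α corr x k).1 (x (k + 1))| ≤ α.maxRat := by
    intro k hk
    rcases Nat.eq_zero_or_pos k with hk0 | hk0
    · subst hk0
      obtain ⟨z, hz⟩ := exists_toRat_eq_compSum_corr corr hcorr x 0 (hx 1 (by omega))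
      rw [show (compSum α corr x 0).2 = 0 from rfl, zero_add, ← hz]
      exact abs_toRat_le_maxRat z
    · -- k ≥ 1: node k-1 of the comb over the corrections e₀ … e_{n-1} (n leaves)
      obtain ⟨m, rfl⟩ : ∃ m, n = m + 1 := ⟨n - 1, by omega⟩
      have hx1 : ∃ y : MiniFloat α, y.toRat = x 1 := hx 1 (by omega)
      have hleavesE : ∀ y ∈ (combTree (fun k => corr (compSum α corr x k).1 (x (k + 1))) m).leaves,
          ∃ z : MiniFloat α, z.toRat = y :=
        forall_leaves_combTree _ _ m (fun i hi => exists_toRat_eq_compSum_corr corr hcorr x i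
          (hx (i + 1) (by omega)))
      have hT2 : TreeInRange α (combTree (fun k => corr (compSum α corr x k).1 (x (k + 1))) m) := by
        refine treeInRange_of_absSum_le hα _ hleavesE ?_
        rw [length_leaves_combTree, absSum_combTree]; push_cast
        rw [show (m : ℚ) + 1 - 1 = m by ring]
        -- (1 + m u') · Σ|e| ≤ (1 + m u') (m+1) u' L ≤ (1 + (m+1) u')² L ≤ maxRat
        push_cast at hE hL
        have hsum0 : 0 ≤ ∑ i ∈ range (m + 1), |corr (compSum α corr x i).1 (x (i + 1))| :=
          sum_nonneg fun _ _ => abs_nonneg _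
        have a1 : 1 + (m : ℚ) * u' ≤ 1 + ((m : ℚ) + 1) * u' := by nlinarith
        have a2 : ((m : ℚ) + 1) * u' ≤ 1 + ((m : ℚ) + 1) * u' := by linarith
        have a3 : 0 ≤ ((m : ℚ) + 1) * u' := by positivity
        have a0 : 0 ≤ 1 + (m : ℚ) * u' := by positivity
        calc (1 + (m : ℚ) * u') * ∑ i ∈ range (m + 1), |corr (compSum α corr x i).1 (x (i + 1))|
            ≤ (1 + (m : ℚ) * u') * (((m : ℚ) + 1) * u' * L) := mul_le_mul_of_nonneg_left hE a0
          _ = ((1 + (m : ℚ) * u') * (((m : ℚ) + 1) * u')) * L := by ring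
          _ ≤ ((1 + ((m : ℚ) + 1) * u') * (1 + ((m : ℚ) + 1) * u')) * L :=
              mul_le_mul_of_nonneg_right (mul_le_mul a1 a2 a3 (by linarith)) hL0
          _ = (1 + ((m : ℚ) + 1) * u') ^ 2 * L := by ring
          _ ≤ α.maxRat := hL
      have hnode := comb_nodes_of_treeInRange _ m hT2 (k - 1) (by omega)
      rw [eval_combTree_eq_compSum_snd corr hcorr x hx1 (k - 1),
        show k - 1 + 1 = k by omega] at hnode
      exact hnode
  refine ⟨hr1, hr2, ?_⟩
  -- final addition: |ŝₙ| ≤ (1 + n u') L, |cₙ| ≤ (1 + (n-1)u') n u' L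
  have hs : |(compSum α corr x n).1| ≤ (1 + n * u') * L := by
    have := abs_eval_le_of_treeInRange hα (combTree x n) hT1
    rw [eval_combTree_eq_compSum_fst corr x (hx 0 (Nat.zero_le _)) n, length_leaves_combTree,
      absSum_combTree] at this
    push_cast at this
    rw [show (n : ℚ) + 1 - 1 = n by ring] at this
    exact this
  have hc : |(compSum α corr x n).2| ≤ (1 + ((n : ℚ) - 1) * u') * (n * u' * L) := by
    have h4 := abs_compSum_snd_sub_sum_corr_le corr hcorr hα x n hx hr2
    have h5 : |∑ k ∈ range n, corr (compSum α corr x k).1 (x (k + 1))|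
        ≤ ∑ k ∈ range n, |corr (compSum α corr x k).1 (x (k + 1))| := abs_sum_le_sum_abs _ _
    have hE0 : 0 ≤ ∑ k ∈ range n, |corr (compSum α corr x k).1 (x (k + 1))| :=
      sum_nonneg fun _ _ => abs_nonneg _
    rcases Nat.eq_zero_or_pos n with hn | hn
    · subst hn; simp [compSum]
    · have hn1 : (1 : ℚ) ≤ n := by exact_mod_cast hn
      have htri : |(compSum α corr x n).2| ≤ |(compSum α corr x n).2
          - ∑ k ∈ range n, corr (compSum α corr x k).1 (x (k + 1))|
          + |∑ k ∈ range n, corr (compSum α corr x k).1 (x (k + 1))| := by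
        have := abs_add_le ((compSum α corr x n).2 - ∑ k ∈ range n, corr (compSum α corr x k).1 (x (k + 1)))
          (∑ k ∈ range n, corr (compSum α corr x k).1 (x (k + 1)))
        rwa [sub_add_cancel] at this
      have e : (1 + ((n : ℚ) - 1) * u') * (n * u' * L)
          = ((n : ℚ) - 1) * u' * (n * u' * L) + n * u' * L := by ring
      rw [e]
      have h6 : ((n : ℚ) - 1) * u' * ∑ k ∈ range n, |corr (compSum α corr x k).1 (x (k + 1))|
          ≤ ((n : ℚ) - 1) * u' * (n * u' * L) :=
        mul_le_mul_of_nonneg_left hE (mul_nonneg (by linarith) hu'0)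
      linarith
  calc |(compSum α corr x n).1 + (compSum α corr x n).2|
      ≤ |(compSum α corr x n).1| + |(compSum α corr x n).2| := abs_add_le _ _
    _ ≤ (1 + n * u') * L + (1 + ((n : ℚ) - 1) * u') * (n * u' * L) := add_le_add hs hc
    _ ≤ (1 + n * u') ^ 2 * L := by nlinarith [mul_nonneg hnu (mul_nonneg hu'0 hL0)]
    _ ≤ α.maxRat := hL

/-- COMPENSATED SUMMATION WITH ANY EFT STEP, RANGE FROM THE DATA: summands in `F_α` (`emaxCode ≥ 2`)
and `(1 + n·u)²·Σ|xᵢ| ≤ maxRat` ⟹ `|res - Σxᵢ| ≤ u·|Σxᵢ| + n(n-1)·u²·Σ|xᵢ|`. [folklore] -/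
theorem abs_compSum_sub_sum_le_of_sum_le (hα : 2 ≤ α.emaxCode) (x : ℕ → ℚ) (n : ℕ)
    (hx : ∀ i ≤ n, ∃ y : MiniFloat α, y.toRat = x i)
    (hL : (1 + n * α.unitRoundoff) ^ 2 * ∑ i ∈ range (n + 1), |x i| ≤ α.maxRat) :
    |compSumRes α corr x n - ∑ i ∈ range (n + 1), x i|
      ≤ α.unitRoundoff * |∑ i ∈ range (n + 1), x i|
        + ((n : ℚ) * (n - 1)) * α.unitRoundoff ^ 2 * ∑ i ∈ range (n + 1), |x i| := by
  have hupos := α.unitRoundoff_pos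
  have hL0 : 0 ≤ ∑ i ∈ range (n + 1), |x i| := sum_nonneg fun _ _ => abs_nonneg _
  have hu' : α.unitRoundoff / (1 + α.unitRoundoff) ≤ α.unitRoundoff := by
    rw [div_le_iff₀ (by linarith)]; nlinarith
  have hu'0 : 0 ≤ α.unitRoundoff / (1 + α.unitRoundoff) := div_nonneg hupos.le (by linarith)
  have hL' : (1 + n * (α.unitRoundoff / (1 + α.unitRoundoff))) ^ 2 * ∑ i ∈ range (n + 1), |x i|
      ≤ α.maxRat := by
    refine le_trans (mul_le_mul_of_nonneg_right ?_ hL0) hL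
    have hn0 : (0 : ℚ) ≤ n := by positivity
    have := mul_le_mul_of_nonneg_left hu' hn0
    nlinarith [mul_nonneg hn0 hu'0]
  obtain ⟨h1, h2, h3⟩ := compSum_ranges corr hcorr hα x n hx hL'
  exact abs_compSum_sub_sum_le corr hcorr hα x n hx h1 h2 h3

end Compensated

/-- NEUMAIER (`kbn`), RANGE FROM THE DATA: summands in `F_α` (`emaxCode ≥ 2`) and
`(1 + n·u)²·Σ|xᵢ| ≤ maxRat` ⟹ `|res - Σxᵢ| ≤ u·|Σxᵢ| + n(n-1)·u²·Σ|xᵢ|`.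
[cite: BoldoEtAl2023, §5.3 (Neumaier1974)] -/
theorem abs_kbnSum_sub_sum_le_of_sum_le (hα : 2 ≤ α.emaxCode) (x : ℕ → ℚ) (n : ℕ)
    (hx : ∀ i ≤ n, ∃ y : MiniFloat α, y.toRat = x i)
    (hL : (1 + n * α.unitRoundoff) ^ 2 * ∑ i ∈ range (n + 1), |x i| ≤ α.maxRat) :
    |kbnSum α x n - ∑ i ∈ range (n + 1), x i|
      ≤ α.unitRoundoff * |∑ i ∈ range (n + 1), x i|
        + ((n : ℚ) * (n - 1)) * α.unitRoundoff ^ 2 * ∑ i ∈ range (n + 1), |x i| := by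
  have e : kbnSum α x n = compSumRes α (kbnCorrFn α) x n := by
    unfold kbnSum compSumRes; rw [kbn_eq_compSum]
  rw [e]
  exact abs_compSum_sub_sum_le_of_sum_le (kbnCorrFn α) kbnCorrFn_eq hα x n hx hL

/-- CASCADED 2SUM (`Sum2`), RANGE FROM THE DATA: summands in `F_α` (`emaxCode ≥ 2`) and
`(1 + n·u)²·Σ|xᵢ| ≤ maxRat` ⟹ `|res - Σxᵢ| ≤ u·|Σxᵢ| + n(n-1)·u²·Σ|xᵢ|`.
[cite: OgitaRumpOishi2005, Algorithm Sum2] -/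
theorem abs_sum2_sub_sum_le_of_sum_le (hα : 2 ≤ α.emaxCode) (x : ℕ → ℚ) (n : ℕ)
    (hx : ∀ i ≤ n, ∃ y : MiniFloat α, y.toRat = x i)
    (hL : (1 + n * α.unitRoundoff) ^ 2 * ∑ i ∈ range (n + 1), |x i| ≤ α.maxRat) :
    |compSumRes α (twoSumCorr α) x n - ∑ i ∈ range (n + 1), x i|
      ≤ α.unitRoundoff * |∑ i ∈ range (n + 1), x i|
        + ((n : ℚ) * (n - 1)) * α.unitRoundoff ^ 2 * ∑ i ∈ range (n + 1), |x i| :=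
  abs_compSum_sub_sum_le_of_sum_le (twoSumCorr α) twoSumCorr_eq hα x n hx hL

end MiniFloat

end Literature.ComputerArithmetic.FloatingPoint
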